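import Mathlib
import HarnessLib
import Summits.HubbardSuperconductivity.HubbardSuperconductivity.Theorems.KLProgrammeKLRegimeVolumeLimitCutoffFreeDefs

/-!
# Child `KLRegimeVolumeLimitV12` (stmt-HubbardSuperconductivity-19858) — MATSUBARA-CUTOFF REMOVAL for the VL carrier: a LABEL-UNIFORM
# `M → ∞` limit at every fixed volume, for EVERY coupling, frame and spin (seat hubbard-kl-k3c5-p3 g4, technique «OS-positivity-free
# direct assembly»; no expansion, no positivity, no Hamiltonian identification)

Both registered stubs of the VL skeleton «cauchy» quantify `∀ M ≥ Mth L` and then over ALL kept labels `ω ∈ [−M, M)`; the Cauchy stub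
(`stub_vl_twoVolumeRate`, with `L = L′` and `M′ → ∞`) even REQUIRES that the finite-cutoff carrier be close to a cutoff-free object uniformly
in the kept label.  This file proves exactly that, unconditionally:

* `eventually_norm_div_sub_div_le_uniform` — bookkeeping: label-uniform limits of quotients `a_M(i)/D_M` from `sup_i ‖a_M(i) − b_M(i)‖ → 0`,
  `‖b_M(i)‖ ≤ A`, `D_M → D∞ ≠ 0`;
* **`klSelfEnergy_bare_cutoffLimit_labelUniform`** — bare frame, spin `↑`: for every `ε > 0`, eventually in `M`, for EVERY label `k = (ω,p)`,
  `‖Σ̂⁰_{L,M}(k,↑) − (U·occ∞ + U²·Six∞_L(n_ω,p))‖ ≤ ε`.  The finite-`M` double Schwinger–Dyson form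
  `Σ̂⁰ = U·occ_M + U²·βL²·b_M(k)/D_M` (`…VolumeLimitSchwingerDyson`, `…Occupation`: the `ĝ⁻² ∼ ω²` growth of the re-amputation is CANCELLED at
  finite `M`) leaves a label-free occupation ratio (`occ_M → occ∞`, t2) and the time-integral Fourier coefficient of the word six-point function
  against a kernel of MODULUS ONE (`sixPoint_up_eq_integral_word`), so `|∫Σ_z φ_k·(S_M − S∞)| ≤ Σ_z ‖S_M(z,·) − S∞(z,·)‖_{L¹[0,β]} → 0`
  uniformly in `k` (pair-word machine + dominated convergence, `klSixWordInf_integrable_and_l1`);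
* `propInt_sub_div_sq_eq` — `(g_K − g₀)/g_K² = K(q)·(g₀/g_K)`;
* **`klSelfEnergy_cutoffLimit_labelUniform`** — EVERY frame `K` and spin: `∃ M₁ ∀ M ≥ M₁ ∀ ω p σ`,
  `‖klSelfEnergy L M β U μ K klE0 (nScales β + 1) (ω,p) σ − klSelfEnergyInf L β U μ K (matsubaraInt M ω) p‖ ≤ ε` (the exact finite-`M` dressing
  `Σ̂^K = (ĝ₀/ĝ_K)²Σ̂⁰ + (ĝ_K − ĝ₀)/ĝ_K²` is cutoff-free on the grid, `propCT_eq_propInt`, and bounded by `(1 + ‖K‖₀β/π)²`; spin independence);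
* **`klSelfEnergy_hcut`** — the `hcut` hypothesis of k3c4-p1's `twoVolumeRate_of_matsubaraLimit` (`…VolumeLimitCauchyMatsubara`) DISCHARGED for
  the TRUE carrier with the proxy `klSelfEnergyInf` and `L₀ = 3`: the Cauchy stub is thereby reduced to its VOLUME direction on cutoff-free objects;
* `eventually_norm_klSelfEnergy_le_of_inf_bound` — a bound on the proxy is, eventually in `M`, a label-uniform bound on the carrier (the
  `stub_vl_bound` direction; doors in `…VolumeLimitCutoffDoor`).
Everything is proved; no definition.
-/

noncomputable section

namespace Summit.HubbardSuperconductivity.HubbardSuperconductivity.Theorems.TwoPointAssembly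

set_option linter.dupNamespace false -- summit = problem name (single-conjunct summit), D-0017

open Finset Filter Topology MeasureTheory intervalIntegral Literature.MathematicalPhysics.QuantumLattice Literature.Probability.LatticeModels
  GrassmannAlgebra
open scoped ComplexConjugate ComplexOrder

/-! ## §1 A generic label-uniform quotient lemma -/

section CutoffRemoval

open Summit.HubbardSuperconductivity.HubbardSuperconductivity.Theorems.KLRegimeSplit
open Summit.HubbardSuperconductivity.HubbardSuperconductivity.Theorems.KLProgrammeLegKernels

/-- **Label-uniform limit of quotients.**  If `‖a M i − b M i‖ ≤ δ M` for all labels `i` eventually, with `δ → 0`, `‖b M i‖ ≤ A`, and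
`D M → D∞ ≠ 0`, then for every `ε > 0` eventually `‖a M i / D M − b M i / D∞‖ ≤ ε` for ALL labels `i`. [folklore] -/
theorem eventually_norm_div_sub_div_le_uniform {ι : ℕ → Type*} (a b : ∀ M, ι M → ℂ) (D : ℕ → ℂ) {Dinf : ℂ} (hDinf : Dinf ≠ 0)
    (hD : Tendsto D atTop (𝓝 Dinf)) {A : ℝ} (hA0 : 0 ≤ A) (hA : ∀ M i, ‖b M i‖ ≤ A) {δ : ℕ → ℝ} (hδ : Tendsto δ atTop (𝓝 0))
    (hab : ∀ᶠ M in atTop, ∀ i, ‖a M i - b M i‖ ≤ δ M) {ε : ℝ} (hε : 0 < ε) :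
    ∀ᶠ M in atTop, ∀ i, ‖a M i / D M - b M i / Dinf‖ ≤ ε := by
  have hDpos : 0 < ‖Dinf‖ := norm_pos_iff.mpr hDinf
  -- (a) `D` stays away from zero
  have hDev : ∀ᶠ M in atTop, ‖Dinf‖ / 2 ≤ ‖D M‖ := by
    have h := hD.eventually (Metric.ball_mem_nhds Dinf (half_pos hDpos))
    filter_upwards [h] with M hM
    rw [dist_eq_norm, ← norm_neg, neg_sub] at hM
    have := norm_sub_norm_le Dinf (D M)
    linarith
  -- (b) the label-free error goes to zero
  have herr : Tendsto (fun M => δ M / (‖Dinf‖ / 2) + A * (‖Dinf - D M‖ / (‖Dinf‖ / 2 * ‖Dinf‖))) atTop (𝓝 0) := by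
    have h1 : Tendsto (fun M => δ M / (‖Dinf‖ / 2)) atTop (𝓝 0) := by
      simpa using hδ.div_const (‖Dinf‖ / 2)
    have h2 : Tendsto (fun M => A * (‖Dinf - D M‖ / (‖Dinf‖ / 2 * ‖Dinf‖))) atTop (𝓝 0) := by
      have h := (tendsto_const_nhds (x := Dinf)).sub hD
      rw [sub_self] at h
      simpa using ((h.norm).div_const (‖Dinf‖ / 2 * ‖Dinf‖)).const_mul A
    simpa using h1.add h2
  filter_upwards [hDev, hab, herr.eventually (gt_mem_nhds hε)] with M hDM habM herrM i
  have hDne : D M ≠ 0 := by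
    intro h; rw [h, norm_zero] at hDM; linarith
  have hDMpos : 0 < ‖D M‖ := norm_pos_iff.mpr hDne
  have hsplit : a M i / D M - b M i / Dinf = (a M i - b M i) / D M + b M i * ((Dinf - D M) / (D M * Dinf)) := by
    field_simp
    ring
  rw [hsplit]
  calc ‖(a M i - b M i) / D M + b M i * ((Dinf - D M) / (D M * Dinf))‖
      ≤ ‖(a M i - b M i) / D M‖ + ‖b M i * ((Dinf - D M) / (D M * Dinf))‖ := norm_add_le _ _
    _ = ‖a M i - b M i‖ / ‖D M‖ + ‖b M i‖ * (‖Dinf - D M‖ / (‖D M‖ * ‖Dinf‖)) := by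
        rw [norm_div, norm_mul, norm_div, norm_mul]
    _ ≤ δ M / (‖Dinf‖ / 2) + A * (‖Dinf - D M‖ / (‖Dinf‖ / 2 * ‖Dinf‖)) := by
        gcongr
        · exact (norm_nonneg _).trans (habM i)
        · exact habM i
        · exact hA M i
    _ ≤ ε := herrM.le

variable {L : ℕ} [NeZero L]

/-! ## §2 The bare spin-`↑` carrier: label-uniform Matsubara limit -/

/-- The Fourier kernel `e^{−iω_n u}·conj χ_p(z)` has modulus one. -/
theorem norm_fourierKernel (β : ℝ) (n : ℤ) (p z : TorusSite 2 L) (u : ℝ) :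
    ‖Complex.exp (-(((Real.pi * (2 * (n : ℝ) + 1) / β * u : ℝ) : ℂ) * Complex.I)) * conj (torusChar p z)‖ = 1 := by
  rw [norm_mul, ← neg_mul, ← Complex.ofReal_neg, Complex.norm_exp_ofReal_mul_I, Complex.norm_conj, norm_torusChar, one_mul]

/-- Continuity in `u` of the Fourier kernel. -/
theorem continuous_fourierKernel (β : ℝ) (n : ℤ) (p z : TorusSite 2 L) :
    Continuous fun u : ℝ => Complex.exp (-(((Real.pi * (2 * (n : ℝ) + 1) / β * u : ℝ) : ℂ) * Complex.I)) * conj (torusChar p z) := by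
  fun_prop

/-- **THE BARE, SPIN-`↑` CARRIER HAS A LABEL-UNIFORM MATSUBARA LIMIT** (every `U`, `L ≥ 3`, `β > 0`): for every `ε > 0`, eventually in `M`,
for EVERY label `k = (ω, p)` of the kept window,
`‖klSelfEnergy L M β U μ 0 klE0 (nScales β + 1) k ↑ − (U·occ∞ + U²·Six∞_L(n_ω, p))‖ ≤ ε`.
Route: the finite-`M` double Schwinger–Dyson form `Σ̂⁰ = U·occ_M + U²·βL²·b_M(k)/D_M` (no `ĝ⁻²` growth), `occ_M → occ∞` (label-free), and the
time-integral Fourier form of the six-point insertion against a kernel of modulus one: `|∫Σ_z φ_k(S_M − S∞)| ≤ Σ_z‖S_M(z,·) − S∞(z,·)‖_{L¹} → 0`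
uniformly in `k`. -/
theorem klSelfEnergy_bare_cutoffLimit_labelUniform (hL : 3 ≤ L) {β : ℝ} (hβ : 0 < β) (U μ : ℝ) {ε : ℝ} (hε : 0 < ε) :
    ∀ᶠ M : ℕ in atTop, ∀ k : FreqMomentum L M,
      ‖klSelfEnergy L M β U μ 0 klE0 (nScales β + 1) k 0 -
          ((U : ℂ) * klOccInf L β U μ + (U : ℂ) ^ 2 * klSixInf L β U μ (matsubaraInt M k.1) k.2)‖ ≤ ε := by
  have hDinf := klDInf_ne_zero (L := L) β U μ
  have hD := tendsto_effPartitionFn_klDInf hL hβ U μ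
  have hDne : ∀ᶠ M : ℕ in atTop, effPartitionFn ℂ (hubbardCovariance L M β μ 0) (hubbardInteraction L M β U) ≠ 0 :=
    hD.eventually_ne hDinf
  -- the word six-point function, its limit, and the `L¹` distances
  set SM : (M : ℕ) → TorusSite 2 L → ℝ → ℂ := fun M z u =>
    gaussExpect ℂ (hubbardCovariance L M β μ 0) (grassmannExp (-(hubbardInteraction L M β U)) * sixPointWord L M β 0 1 z u) with hSM_def
  set Sinf : TorusSite 2 L → ℝ → ℂ := klSixWordInf L β U μ with hSinf_def
  have hSi : ∀ z, IntervalIntegrable (Sinf z) volume 0 β := fun z => (klSixWordInf_integrable_and_l1 hβ U μ z).1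
  have hSl1 : ∀ z, Tendsto (fun M : ℕ => ∫ u in (0 : ℝ)..β, ‖SM M z u - Sinf z u‖) atTop (𝓝 0) := fun z =>
    (klSixWordInf_integrable_and_l1 hβ U μ z).2
  have hSMc : ∀ M z, Continuous (SM M z) := fun M z => continuous_wordSixPoint_up (L := L) (M := M) β U μ z
  set δ : ℕ → ℝ := fun M => ∑ z : TorusSite 2 L, ∫ u in (0 : ℝ)..β, ‖SM M z u - Sinf z u‖ with hδ_def
  have hδ : Tendsto δ atTop (𝓝 0) := by
    have := tendsto_finsetSum (Finset.univ : Finset (TorusSite 2 L)) fun z _ => hSl1 z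
    simpa [hδ_def] using this
  -- the Fourier kernel at an integer label
  set φ : ℤ → TorusSite 2 L → TorusSite 2 L → ℝ → ℂ := fun n p z u =>
    Complex.exp (-(((Real.pi * (2 * (n : ℝ) + 1) / β * u : ℝ) : ℂ) * Complex.I)) * conj (torusChar p z) with hφ_def
  have hφnorm : ∀ n p z u, ‖φ n p z u‖ = 1 := fun n p z u => norm_fourierKernel β n p z u
  have hφc : ∀ n p z, Continuous (φ n p z) := fun n p z => continuous_fourierKernel β n p z
  -- the transforms `a` (finite `M`) and `b` (limit) at the label `k`
  set a : (M : ℕ) → FreqMomentum L M → ℂ := fun M k =>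
    ∫ u in (0 : ℝ)..β, ∑ z : TorusSite 2 L, φ (matsubaraInt M k.1) k.2 z u * SM M z u with ha_def
  set b : (M : ℕ) → FreqMomentum L M → ℂ := fun M k =>
    ∫ u in (0 : ℝ)..β, ∑ z : TorusSite 2 L, φ (matsubaraInt M k.1) k.2 z u * Sinf z u with hb_def
  -- the label-free bound of `b`
  set A : ℝ := ∫ u in (0 : ℝ)..β, ∑ z : TorusSite 2 L, ‖Sinf z u‖ with hA_def
  have hnormint : IntervalIntegrable (fun u => ∑ z : TorusSite 2 L, ‖Sinf z u‖) volume 0 β := by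
    have h := IntervalIntegrable.sum (Finset.univ : Finset (TorusSite 2 L)) fun z _ => (hSi z).norm
    simpa only [Finset.sum_fn] using h
  have hA0 : 0 ≤ A := intervalIntegral.integral_nonneg hβ.le fun u _ => Finset.sum_nonneg fun z _ => norm_nonneg _
  have hbA : ∀ M k, ‖b M k‖ ≤ A := by
    intro M k
    rw [hb_def, hA_def]
    refine intervalIntegral.norm_integral_le_of_norm_le hβ.le (Filter.Eventually.of_forall fun u _ => ?_) hnormint
    refine (norm_sum_le _ _).trans (Finset.sum_le_sum fun z _ => ?_)
    rw [norm_mul, hφnorm, one_mul]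
  -- the label-uniform comparison `‖a − b‖ ≤ δ`
  have hab : ∀ᶠ M : ℕ in atTop, ∀ k : FreqMomentum L M, ‖a M k - b M k‖ ≤ δ M := by
    refine Filter.Eventually.of_forall fun M k => ?_
    have hint1 : IntervalIntegrable (fun u => ∑ z : TorusSite 2 L, φ (matsubaraInt M k.1) k.2 z u * SM M z u) volume 0 β :=
      (continuous_finsetSum _ fun z _ => (hφc (matsubaraInt M k.1) k.2 z).mul (hSMc M z)).intervalIntegrable _ _
    have hint2 : IntervalIntegrable (fun u => ∑ z : TorusSite 2 L, φ (matsubaraInt M k.1) k.2 z u * Sinf z u) volume 0 β := by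
      have h := IntervalIntegrable.sum (Finset.univ : Finset (TorusSite 2 L)) fun z _ =>
        ((hSi z).continuousOn_mul (hφc (matsubaraInt M k.1) k.2 z).continuousOn)
      simpa only [Finset.sum_fn] using h
    have hg : IntervalIntegrable (fun u => ∑ z : TorusSite 2 L, ‖SM M z u - Sinf z u‖) volume 0 β := by
      have h := IntervalIntegrable.sum (Finset.univ : Finset (TorusSite 2 L)) fun z _ =>
        ((((hSMc M z).intervalIntegrable (0 : ℝ) β).sub (hSi z)).norm)
      simpa only [Finset.sum_fn] using h
    rw [ha_def, hb_def]
    dsimp only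
    rw [← intervalIntegral.integral_sub hint1 hint2]
    refine (intervalIntegral.norm_integral_le_of_norm_le hβ.le (Filter.Eventually.of_forall fun u _ => ?_) hg).trans ?_
    · rw [← Finset.sum_sub_distrib]
      refine (norm_sum_le _ _).trans (Finset.sum_le_sum fun z _ => ?_)
      rw [← mul_sub, norm_mul, hφnorm, one_mul]
    · rw [intervalIntegral.integral_finsetSum fun z _ => ((((hSMc M z).intervalIntegrable (0 : ℝ) β).sub (hSi z)).norm)]
  -- the six-point half: label-uniform limit of the quotients
  have hε2 : 0 < ε / (2 * (U ^ 2 + 1)) := by positivity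
  have hsix := eventually_norm_div_sub_div_le_uniform a b
    (fun M => effPartitionFn ℂ (hubbardCovariance L M β μ 0) (hubbardInteraction L M β U)) hDinf hD hA0 hbA hδ hab hε2
  -- the occupation half
  have hocc : ∀ᶠ M : ℕ in atTop,
      ‖(U : ℂ) * ((((1 / (β * (L : ℝ) ^ 2) ^ 2 : ℝ) : ℂ)) *
            (∑ q : FreqMomentum L M,
              gaussExpect ℂ (hubbardCovariance L M β μ 0)
                (gen ℂ (((q, (1 : Fin 2)), 0) : HubbardFieldIdx L M) * gen ℂ (((q, (1 : Fin 2)), 1) : HubbardFieldIdx L M) *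
                  grassmannExp (-(hubbardInteraction L M β U)))) /
          effPartitionFn ℂ (hubbardCovariance L M β μ 0) (hubbardInteraction L M β U)) - (U : ℂ) * klOccInf L β U μ‖ < ε / 2 := by
    have h := ((tendsto_occupationRatio_klOccInf hL hβ U μ).const_mul (U : ℂ))
    have h2 := Metric.tendsto_nhds.1 h (ε / 2) (half_pos hε)
    filter_upwards [h2] with M hM
    rwa [dist_eq_norm] at hM
  -- assemble
  filter_upwards [hDne, hsix, hocc] with M hDM hsixM hoccM k
  have h10 : (1 : Fin 2) - 0 = 1 := rfl
  have hsix : ((β * (L : ℝ) ^ 2 : ℝ) : ℂ) *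
        gaussExpect ℂ (hubbardCovariance L M β μ 0)
          (grassmannExp (-(hubbardInteraction L M β U)) *
            (grassmannDeriv ℂ (((k, 0), 0) : HubbardFieldIdx L M) (hubbardInteraction L M β 1) *
              grassmannDeriv ℂ (((k, 0), 1) : HubbardFieldIdx L M) (hubbardInteraction L M β 1))) = a M k := by
    rw [ha_def, hφ_def, hSM_def]
    simpa only [matsubaraFreq] using sixPoint_up_eq_integral_word hβ.ne' U μ k
  have hcar : klSelfEnergy L M β U μ 0 klE0 (nScales β + 1) k 0 =
      (U : ℂ) * ((((1 / (β * (L : ℝ) ^ 2) ^ 2 : ℝ) : ℂ)) *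
            (∑ q : FreqMomentum L M,
              gaussExpect ℂ (hubbardCovariance L M β μ 0)
                (gen ℂ (((q, (1 : Fin 2)), 0) : HubbardFieldIdx L M) * gen ℂ (((q, (1 : Fin 2)), 1) : HubbardFieldIdx L M) *
                  grassmannExp (-(hubbardInteraction L M β U)))) /
          effPartitionFn ℂ (hubbardCovariance L M β μ 0) (hubbardInteraction L M β U)) +
        (U : ℂ) ^ 2 * (a M k / effPartitionFn ℂ (hubbardCovariance L M β μ 0) (hubbardInteraction L M β U)) := by
    rw [klSelfEnergy_nScales_succ_eq_selfEnergy_fullActionCT hβ, selfEnergy_fullActionCT_bare_eq_occupation_add hβ.ne' U μ k 0 hDM,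
      h10, ← hsix]
    ring
  have hbk : b M k / klDInf L β U μ = klSixInf L β U μ (matsubaraInt M k.1) k.2 := by
    rw [hb_def, klSixInf]
  rw [hcar, ← hbk]
  have hU2 : ‖(U : ℂ) ^ 2‖ = U ^ 2 := by rw [norm_pow, Complex.norm_real, Real.norm_eq_abs, sq_abs]
  calc _ = ‖((U : ℂ) * ((((1 / (β * (L : ℝ) ^ 2) ^ 2 : ℝ) : ℂ)) *
            (∑ q : FreqMomentum L M,
              gaussExpect ℂ (hubbardCovariance L M β μ 0)
                (gen ℂ (((q, (1 : Fin 2)), 0) : HubbardFieldIdx L M) * gen ℂ (((q, (1 : Fin 2)), 1) : HubbardFieldIdx L M) *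
                  grassmannExp (-(hubbardInteraction L M β U)))) /
          effPartitionFn ℂ (hubbardCovariance L M β μ 0) (hubbardInteraction L M β U)) - (U : ℂ) * klOccInf L β U μ) +
          (U : ℂ) ^ 2 * (a M k / effPartitionFn ℂ (hubbardCovariance L M β μ 0) (hubbardInteraction L M β U) - b M k / klDInf L β U μ)‖ := by
        congr 1; ring
    _ ≤ ε / 2 + U ^ 2 * (ε / (2 * (U ^ 2 + 1))) := by
        refine (norm_add_le _ _).trans (add_le_add hoccM.le ?_)
        rw [norm_mul, hU2]
        exact mul_le_mul_of_nonneg_left (hsixM k) (sq_nonneg U)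
    _ ≤ ε := by
        have h1 : U ^ 2 * (ε / (2 * (U ^ 2 + 1))) ≤ ε / 2 := by
          rw [mul_div_assoc']
          rw [div_le_div_iff₀ (by positivity) (by norm_num : (0:ℝ) < 2)]
          nlinarith [sq_nonneg U, hε.le]
        linarith

/-! ## §3 Every frame, every spin: the label-uniform Matsubara limit of the VL carrier -/

/-- `(g_K − g₀)/g_K² = K(q)·(g₀/g_K)`: the additive frame term is the frame function times the dressing (`β ≠ 0`). -/
theorem propInt_sub_div_sq_eq {β : ℝ} (hβ : β ≠ 0) (μ : ℝ) (K : TrigPolyC4v) (n : ℤ) (q : Fin 2 → ℝ) :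
    (propInt β μ K n q - propInt β μ 0 n q) / propInt β μ K n q ^ 2 = (K.eval q : ℂ) * (propInt β μ 0 n q / propInt β μ K n q) := by
  have hD0 := propInt_den_ne_zero hβ μ 0 n q
  have hDK := propInt_den_ne_zero hβ μ K n q
  set dK : ℂ := -Complex.I * (freqOfInt β n : ℂ) + (bandCT μ K q : ℂ) with hdK
  set d0 : ℂ := -Complex.I * (freqOfInt β n : ℂ) + (bandCT μ 0 q : ℂ) with hd0
  have hrel : (K.eval q : ℂ) = d0 - dK := by
    rw [hd0, hdK]; simp only [bandCT, TrigPolyC4v.eval_zero]; push_cast; ring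
  have h1 : propInt β μ K n q = 1 / dK := rfl
  have h2 : propInt β μ 0 n q = 1 / d0 := rfl
  rw [h1, h2, hrel]
  field_simp

/-- **THE VL CARRIER HAS A LABEL-UNIFORM MATSUBARA LIMIT — every coupling, every frame, every spin** (`L ≥ 3`, `β > 0`): for every `ε > 0`
there is `M₁` such that for all `M ≥ M₁` and EVERY kept label `(ω, p)` and spin `σ`,
`‖klSelfEnergy L M β U μ K klE0 (nScales β + 1) (ω, p) σ − klSelfEnergyInf L β U μ K (matsubaraInt M ω) p‖ ≤ ε`.
(Frame: the exact finite-`M` dressing `Σ̂^K = (ĝ₀/ĝ_K)²Σ̂⁰ + (ĝ_K − ĝ₀)/ĝ_K²` is cutoff-free and bounded by `(1 + ‖K‖₀β/π)²`; spin: `Σ̂` is spin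
independent.) -/
theorem klSelfEnergy_cutoffLimit_labelUniform (hL : 3 ≤ L) {β : ℝ} (hβ : 0 < β) (U μ : ℝ) (K : TrigPolyC4v) {ε : ℝ} (hε : 0 < ε) :
    ∃ M₁ : ℕ, ∀ (M : ℕ) [NeZero M], M₁ ≤ M → ∀ (ω : MatsubaraIdx M) (p : TorusSite 2 L) (σ : Fin 2),
      ‖klSelfEnergy L M β U μ K klE0 (nScales β + 1) (ω, p) σ - klSelfEnergyInf L β U μ K (matsubaraInt M ω) p‖ ≤ ε := by
  set R : ℝ := 1 + K.coeffNorm 0 * (β / Real.pi) with hR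
  have hR1 : 1 ≤ R := le_add_of_nonneg_right (mul_nonneg (TrigPolyC4v.coeffNorm_nonneg 0 K) (div_nonneg hβ.le Real.pi_pos.le))
  have hR0 : 0 < R := lt_of_lt_of_le one_pos hR1
  have hε' : 0 < ε / R ^ 2 := by positivity
  have hbare := klSelfEnergy_bare_cutoffLimit_labelUniform hL hβ U μ hε'
  have hDne : ∀ᶠ M : ℕ in atTop, effPartitionFn ℂ (hubbardCovariance L M β μ 0) (hubbardInteraction L M β U) ≠ 0 :=
    (tendsto_effPartitionFn_klDInf hL hβ U μ).eventually_ne (klDInf_ne_zero β U μ)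
  obtain ⟨M₁, hM₁⟩ := Filter.eventually_atTop.1 (hbare.and hDne)
  refine ⟨M₁, fun M _ hM ω p σ => ?_⟩
  obtain ⟨hb, hD⟩ := hM₁ M hM
  set q : Fin 2 → ℝ := latticeMomentum L p with hq
  set r : ℂ := propInt β μ 0 (matsubaraInt M ω) q / propInt β μ K (matsubaraInt M ω) q with hr
  have hrle : ‖r‖ ≤ R := norm_propInt_div_propInt_le hβ μ K _ q
  -- finite `M`: spin, then frame dressing
  have hfin : klSelfEnergy L M β U μ K klE0 (nScales β + 1) (ω, p) σ =
      r ^ 2 * klSelfEnergy L M β U μ 0 klE0 (nScales β + 1) (ω, p) 0 +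
        (propInt β μ K (matsubaraInt M ω) q - propInt β μ 0 (matsubaraInt M ω) q) / propInt β μ K (matsubaraInt M ω) q ^ 2 := by
    rw [klSelfEnergy_nScales_succ_spin_eq, klSelfEnergy_nScales_succ_eq_selfEnergy_fullActionCT hβ,
      klSelfEnergy_nScales_succ_eq_selfEnergy_fullActionCT hβ, selfEnergy_fullActionCT_eq_schwingerDyson hβ.ne' U μ K (ω, p) 0 hD,
      propCT_eq_propInt, propCT_eq_propInt]
  -- cutoff-free side: the same dressing
  have hinf : klSelfEnergyInf L β U μ K (matsubaraInt M ω) p =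
      r ^ 2 * klSelfEnergyInf L β U μ 0 (matsubaraInt M ω) p +
        (propInt β μ K (matsubaraInt M ω) q - propInt β μ 0 (matsubaraInt M ω) q) / propInt β μ K (matsubaraInt M ω) q ^ 2 :=
    klSelfEnergyInf_eq_dressing hβ.ne' U μ K _ p
  rw [hfin, hinf, add_sub_add_right_eq_sub, ← mul_sub, norm_mul, norm_pow, klSelfEnergyInf_zero_frame hβ.ne']
  have hbk := hb (ω, p)
  calc ‖r‖ ^ 2 * ‖klSelfEnergy L M β U μ 0 klE0 (nScales β + 1) (ω, p) 0 -
          ((U : ℂ) * klOccInf L β U μ + (U : ℂ) ^ 2 * klSixInf L β U μ (matsubaraInt M ω) p)‖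
      ≤ R ^ 2 * (ε / R ^ 2) := by
        gcongr
    _ = ε := by field_simp

/-! ## §4 The cutoff direction of the Cauchy stub, discharged for the true carrier -/

/-- **THE `hcut` HYPOTHESIS OF `twoVolumeRate_of_matsubaraLimit` HOLDS FOR THE TRUE CARRIER**, with the cutoff-free proxy
`Sinf L n p σ := klSelfEnergyInf L β U μ K n p`, threshold `L₀ = 3`, for EVERY real `U`, every `μ`, every frame `K` and `β > 0`. -/
theorem klSelfEnergy_hcut {β : ℝ} (hβ : 0 < β) (U μ : ℝ) (K : TrigPolyC4v) :
    ∀ (L : ℕ) [NeZero L], 3 ≤ L → ∀ ε : ℝ, 0 < ε → ∃ M₁ : ℕ, ∀ (M : ℕ) [NeZero M], M₁ ≤ M →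
      ∀ (ω : MatsubaraIdx M) (k : TorusSite 2 L) (σ : Fin 2),
        ‖klSelfEnergy L M β U μ K klE0 (nScales β + 1) (ω, k) σ - klSelfEnergyInf L β U μ K (matsubaraInt M ω) k‖ ≤ ε :=
  fun _ _ hL _ hε => klSelfEnergy_cutoffLimit_labelUniform hL hβ U μ K hε

/-- **An `L`-pointwise consequence: eventually in `M` the carrier is bounded by the cutoff-free proxy plus one**, at every label. -/
theorem eventually_norm_klSelfEnergy_le_of_inf_bound (hL : 3 ≤ L) {β : ℝ} (hβ : 0 < β) (U μ : ℝ) (K : TrigPolyC4v) {B : ℝ}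
    (hB : ∀ (n : ℤ) (p : TorusSite 2 L), ‖klSelfEnergyInf L β U μ K n p‖ ≤ B) :
    ∃ M₁ : ℕ, ∀ (M : ℕ) [NeZero M], M₁ ≤ M → ∀ (k : FreqMomentum L M) (σ : Fin 2),
      ‖klSelfEnergy L M β U μ K klE0 (nScales β + 1) k σ‖ ≤ B + 1 := by
  obtain ⟨M₁, hM₁⟩ := klSelfEnergy_cutoffLimit_labelUniform hL hβ U μ K one_pos
  refine ⟨M₁, fun M _ hM k σ => ?_⟩
  have h := hM₁ M hM k.1 k.2 σ
  have := norm_le_norm_sub_add (klSelfEnergy L M β U μ K klE0 (nScales β + 1) k σ) (klSelfEnergyInf L β U μ K (matsubaraInt M k.1) k.2)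
  linarith [hB (matsubaraInt M k.1) k.2]

end CutoffRemoval

end Summit.HubbardSuperconductivity.HubbardSuperconductivity.Theorems.TwoPointAssembly

end
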